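import Summits.Ventures.AbcSig.Rows.XTemplateC2a
import Summits.Ventures.AbcSig.Rows.C2aL283A0

/-!
# Venture AbcSig — ROW `C2aL283A0AB`: `283^m·xⁿ + yⁿ = z²` (second distribution, by symmetry), class `a = 0`, over the level files 9056 (norm-form certificates) and 566 (ordinary tree certificates) (GENERATED by p-lean g4 `gen4/c2arow2.py`)

HONEST FRAMING. A row of a COMPUTATION cell (`pub-abcsig`); a CONDITIONAL theorem, no claim on ABC or any summit.
Hypotheses: `BS04Package` (CITED: [BS04] Lemma 3.3 + (3.1) + Lemma 4.2); `DataComplete` at both levels and `RefinesCPSymAll` at the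
norm-form level(s) (COMPUTED: certified engine-1 level files; `Sieve/CharpolyCert.lean` / `Sieve/CharpolyTwist.lean`); `EisPackage` (CITED) + `Refines` (COMPUTED) for module-M6 residues discharged IN THE KERNEL at level 566;
and the listed per-orbit exclusions `hX_…` (CITED: the row of record's module closures — M4 Kraus / M6 / M8 / [BS04, Prop 4.4/4.6] as its R3
names them; nothing of those is checked here). Exponent range: prime `n ≥ 11`, `n ≠ 283`, n ∉ [11]; `B = 2^0·283^m`, `1 ≤ m < n`
(RULING H1 reduced exponents).
Residual of record R = {11} EXCLUDED in the statement (hres). CITED per the row of record's R3 at 9056: 9056.9 @ 71: M4/M6c-old; 9056.12 @ 71: M4/M6c-old. Level 566 (tree): 566.7 @ 71: M4/M6; kernel M6 discharges 7:71.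
Row of record: `census/rows/C2a/C2a-l283-a0.md` (sha16 `9b89195cd02fa291`; SIGNED 2026-08-22T17:51:55Z by referee (ref-g14)).
-/

namespace Summit.Ventures.AbcSig

/-- Row `C2aL283A0AB`: `a = 0`, second distribution `(283^m, 1)` — the first with `x, y` swapped (`IsPrimitiveSolution.swap`). -/
theorem xrow_C2aL283A0AB (M : NewformModel) (hP : M.BS04Package)
    (hE : M.EisPackage)
    (hR_orbit_566_7 : M.Refines 566 orbit_566_7 m6X_566_7)
    (hD9056 : M.DataComplete 9056 level9056Orbits) (hCP9056 : M.RefinesCPSymAll 9056 level9056CP)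
    (hD566 : M.DataComplete 566 level566Orbits)
    (n : ℕ) (hn : n.Prime) (hmin : 11 ≤ n) (hnℓ : n ≠ 283) (hres : n ∉ ([11] : List ℕ)) (m : ℕ) (hm : 1 ≤ m) (hmn : m < n)
    (hX_orbit_9056_9 : n ∈ ([71] : List ℕ) → M.Excludes 9056 orbit_9056_9
      (famB (2 ^ 0 * 283 ^ m) n (fun _ _ => True)))
    (hX_orbit_9056_12 : n ∈ ([71] : List ℕ) → M.Excludes 9056 orbit_9056_12
      (famB (2 ^ 0 * 283 ^ m) n (fun _ _ => True)))
    (x y z : ℤ) (hxy1 : x * y ≠ 1) (hxy2 : x * y ≠ -1) : ¬ IsPrimitiveSolution (283 ^ m) (2 ^ 0) 1 n x y z := by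
  intro h
  have h' : IsPrimitiveSolution 1 (2 ^ 0 * 283 ^ m) 1 n y x z := by simpa only [pow_zero, one_mul] using h.swap
  exact xrow_C2aL283A0 M hP hE hR_orbit_566_7 hD9056 hCP9056 hD566 n hn hmin hnℓ hres m hm hmn hX_orbit_9056_9 hX_orbit_9056_12 y x z (by rwa [mul_comm]) (by rwa [mul_comm]) h'

end Summit.Ventures.AbcSig
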